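import Literature.NumberTheory.EllipticCurves.Curve5077aRank
import Literature.NumberTheory.EllipticCurves.BSDRootNumberSmallConductorRankProofs
import Literature.NumberTheory.EllipticCurves.BSDRootNumberOddParityProofs
import HarnessLib

/-!
# The curve 5077a: `ord_{s=1} L(E,s) ≥ 3` from two rational points and the sign (LINK-K)

Buhler–Gross–Zagier 1985, p. 479: «Since L(s) has odd order, we have ord_{s=1} L(s) ≥ 3» — the
order-3 input of Goldfeld's solution of Gauss's class number problem (Gross–Zagier 1986 (8.2),
Oesterlé 1985: `h(−d) > (1/55) log d` for `(d, 5077) = 1`). BGZ obtain `L′(E,1) = 0` from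
Gross–Zagier and the absence of rational points of small height; the route formalised here is
Cremona's (1997, §2.13): Kolyvagin's theorem contraposed — if `ord ≤ 1` then `rank E(ℚ) = ord ≤ 1`,
contradicting the two (indeed three) independent points of `Curve5077aRank.lean` — and the
unconditional odd parity for `w(E) = −1`.

What is proved here (all for `E = Curve5077a.E : y² + y = x³ − 7x + 6`):
* `linearIndependent_P₀_P₁` — the minimal exact certificate (two points);
* `three_le_analyticRank (hGZK) (hw)` — «two independent rational points and `w = −1` certify a
  triple zero»;
* `analyticRank_eq_three (hGZK) (hw) (h3)` — with the upper bound `ord ≤ 3` (`L‴(E,1) ≠ 0`,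
  BGZ (14), a certified ball) as hypothesis `h3`.

Hypotheses kept (deliberately NOT discharged here): `hGZK` = the named fact
`rank_eq_analyticRank_of_analyticRank_le_one` (Gross–Zagier–Kolyvagin with modularity);
`hw : E.rootNumber = −1` = the named fact `rootNumber_eq_algebraicRootNumber` plus the local
computation «non-split multiplicative at 5077 (a₅₀₇₇ = −1), good reduction elsewhere (Δ = 5077)»
(BGZ (10): Λ(s) = −Λ(2−s)); `h3` = the certified enclosure of `L‴(E,1)/3!`
(`1.7318499001193006897919750850601528…`, two code-disjoint lineages in the rh-explicit Goldfeld
track).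

## References
* J. P. Buhler, B. H. Gross, D. B. Zagier, Math. Comp. 44 (1985) 473–481, §4 p. 479, eq. (14).
  [BuhlerGrossZagier1985]
* J. E. Cremona, *Algorithms for Modular Elliptic Curves*, 2nd ed. (1997), §2.13.
  [CremonaAlgorithms1997]
-/

namespace Literature.NumberTheory.EllipticCurves.Curve5077a

open WeierstrassCurve


/-- Two of the BGZ points already suffice: `P₀, P₁` are `ℤ`-independent.
[cite: BuhlerGrossZagier1985, §2 p. 475] -/
theorem linearIndependent_P₀_P₁ : LinearIndependent ℤ ![P₀, P₁] := by
  have h := linearIndependent_P.comp ![(0 : Fin 3), 1] (by decide)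
  convert h using 1
  ext i
  fin_cases i <;> rfl

/-- **«Two independent rational points and `w = −1` certify a triple zero»**: for `5077a`,
Gross–Zagier–Kolyvagin (named fact `hGZK`) and the sign `w(E) = −1` give `3 ≤ ord_{s=1} L(E,s)`
(BGZ 1985 p. 479; Cremona 1997 §2.13). Numerics-free. [cite: BuhlerGrossZagier1985, §4 p. 479] -/
theorem three_le_analyticRank
    (hGZK : Literature.NumberTheory.EllipticCurves.rank_eq_analyticRank_of_analyticRank_le_one)
    (hw : E.rootNumber = -1) : 3 ≤ E.analyticRank := by
  have h2 := Literature.NumberTheory.EllipticCurves.two_le_analyticRank_of_two_le_mordellWeilRank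
    E hGZK (le_trans (by norm_num) three_le_mordellWeilRank)
  obtain ⟨k, hk⟩ := WeierstrassCurve.odd_analyticRank_of_rootNumber_eq_neg_one hw
  omega

/-- **`ord_{s=1} L(5077a, s) = 3`** from the chain: the lower bound `three_le_analyticRank` and the
upper bound `r_an ≤ 3`, i.e. `L‴(E,1) ≠ 0` (BGZ 1985 (14): `lim L(s)/(s−1)³ ≈ 1.7318499001193…`;
a certified enclosure excluding `0` — hypothesis `h3`). [cite: BuhlerGrossZagier1985, §4 eq. (14)] -/
theorem analyticRank_eq_three
    (hGZK : Literature.NumberTheory.EllipticCurves.rank_eq_analyticRank_of_analyticRank_le_one)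
    (hw : E.rootNumber = -1) (h3 : E.analyticRank ≤ 3) : E.analyticRank = 3 :=
  Literature.NumberTheory.EllipticCurves.analyticRank_eq_three_of_rootNumber_eq_neg_one E hGZK hw
    h3 (le_trans (by norm_num) three_le_mordellWeilRank)

end Literature.NumberTheory.EllipticCurves.Curve5077a
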